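import Summits.QuantumFields.BalabanUV.Beta.GAN24.CombContactGaugeRefine
import Summits.QuantumFields.BalabanUV.Beta.GAN24.ContactRefineBUnits

/-!
# `BalabanUV.Beta.GAN24.CombContactRefineBUnits` — binder row G-an2-4 ∕ (CONV-C), TRANSFER-III, the (III′) S-slot (b) of the END R `CombChargeRowsClosed`, the (III′) WILSON CONTACT
# RATE END `hCTd′`, step CT-4c-B AT THE COMB CHART, part 1: **THE UNIT LETTERS OF THE CONJUGATED BOND GAUGE FUNCTION** — the (III′) twin of the gauge-side half of leaf-02 g50's (E)
# `ContactRefineBUnits` §1 (the leg-side and tent-side unit letters `abs_unitLeg_le ∕ abs_unitTent_le ∕ abs_unitLeg_refine_le ∕ abs_unitTent_refine_le` are gauge-blind and are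
# consumed BY NAME from the (E) file): `N^4·λ′_k` has the `k`-free block envelope `2·(8LcC + F·c₁·C)` (MY `abs_combGauge_le`); the site-differenced unit gauge function is
# `(3·α_d·θ^k + 2·α₀·N′⁻¹)`-small (MY `CombContactGaugeRefine`); the unit staircase of tower `k` has `k+2` pieces with amplitudes `α₀·N⁻¹·Lc^s` (MY `abs_combPieceZero_le`), whose
# realignment weight is `Σ_{s<k+2} a s·(Lc^s)⁻¹ = (k+2)·α₀·N⁻¹`.

NOT IN PRINT; OUR BOOKKEEPING (G-an2-4 formalisation swarm, leaf prover `b2b-balaban-gan24-formalise-leaf-01`, gen 89; [folklore] unit bookkeeping BY NAME; 0 `def`, 0 cited facts,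
0 `def … : Prop`, 0 sorry).  HONEST FRAMING (cell contract, verbatim): «discharging `BetaPertH` makes Bałaban's UV stability UNCONDITIONAL — a real constructive-QFT result; it is NOT
the continuum limit and NOT the Clay problem.»  HONEST DEPENDENCY (verbatim): «continuum YM on T⁴ ⇐ BetaPertH ∧ nine spine estimates (0/9 proved); BetaPertH ⇐ (D1) ∧ (D4) ∧ CAP+tail;
G-an2-4 gates asym, D1 and NE2/3/4.»  These are the `hdψ ∕ hdW`-side inputs of the (III′) twins of leaf-02's `ContactRefineBThree` (the three B-atom ENDs) — successor work
(`g89/S-SLOT-LETTERS-SIZING-g89.md` §1 step (3)).  NO estimate of Bałaban's; discharges NOTHING of `hCTd′` by itself; NEVER «G-an2-4 closed» as (CONV-C); NOT D1, NOT BetaPertH,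
NOT continuum, NOT Clay.  2026-08-28; no existing file touched.
-/

noncomputable section

open Finset
open scoped BigOperators
open Literature.MathematicalPhysics.QuantumFieldTheory
open Literature.MathematicalPhysics.QuantumFieldTheory.LatticeForm (quo)
open Literature.MathematicalPhysics.QuantumFieldTheory.Balaban1983to89
open Literature.MathematicalPhysics.QuantumFieldTheory.Balaban1983to89.Beta
open B4ContourShift (supNorm supNorm_nonneg)
open AffineAveraging (Form0 Form1 Site box toSite)
open AveragingContours (blk)
open KKTFluctuationKernel (delta1)
open BalabanCompositeJets (respStep)
open Summit.QuantumFields.BalabanUV.Beta.AxialProjectorBlockMean (bmGaugeAt)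
open Summit.QuantumFields.BalabanUV.Beta.SymCorrectorForms (zetaS)
open Summit.QuantumFields.BalabanUV.Beta.SymCorrectorFace (faceWtSum faceWtSum_nonneg)
open Summit.QuantumFields.BalabanUV.Beta.GAN24.Push4Iter (legChain)
open Summit.QuantumFields.BalabanUV.Beta.GAN24.RespStepBmDecompLegs (legAct)
open Summit.QuantumFields.BalabanUV.Beta.GAN24.RespStepBmDecompExact (respStepBmSeq)
open Summit.QuantumFields.BalabanUV.Beta.GAN24.RespStepBmDecompPsi (Psi)
open Summit.QuantumFields.BalabanUV.Beta.GAN24.CombLegChainGauge (PsiFace)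
open Summit.QuantumFields.BalabanUV.Beta.GAN24.CombContactGaugeStaircase (abs_combGauge_le)
open Summit.QuantumFields.BalabanUV.Beta.GAN24.CombContactGaugeStaircaseCauchy (combGauge_eq_staircase_zero)
open Summit.QuantumFields.BalabanUV.Beta.GAN24.CombContactGaugeStaircaseCauchyPack (abs_combPieceZero_le)
open Summit.QuantumFields.BalabanUV.Beta.GAN24.ContactRefineBUnits (pow_mul_pow_mul_inv_eq_one)

namespace Summit.QuantumFields.BalabanUV.Beta.GAN24.CombContactRefineBUnits

variable {Lc : ℕ} [NeZero Lc]

/-! ## §1 The unit letters of the conjugated bond gauge function (`d = 3`) -/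

section Units

variable {κ₀ C F αd α₀ θ κ : ℝ} {r rr : Fin (3 + 1) → ℕ}

/-- NOT IN PRINT; OUR BOOKKEEPING.  **THE UNIT CONJUGATED GAUGE FUNCTION** `N^4·λ′_k` has the `k`-FREE block envelope `2·(8LcC + F·(1+8Lc(e^{κ₀}+1))·C)` (MY `abs_combGauge_le`:
`|λ′_k| ≤ 2·α₁·Lc^{k+1}·E`, `α₁ = (8LcC + F·c₁·C)·(Lc^{5(k+1)})⁻¹`, and `N^4·Lc^{k+1} = Lc^{5(k+1)}`). -/
theorem abs_unitCombGauge_le (hLc : 2 ≤ Lc) (hκ₀ : 0 ≤ κ₀) (hC : 0 ≤ C)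
    (hN1 : ∀ (m k : ℕ) (μ : Fin (3 + 1)) (z : Site (3 + 1)) (l'' : Fin (3 + 1)) (w' : Site (3 + 1)),
      |respStep (d := 3) (Lc ^ m) (Lc ^ (m + k + 1)) μ z l'' w'| ≤
        C * ((Lc : ℝ) ^ (5 * (k + 1)))⁻¹ * Real.exp (-(κ₀ * supNorm (quo (Lc ^ (k + 1)) w' - z))))
    (hr : r ∈ box (3 + 1) Lc) (hrr : rr ∈ box (3 + 1) Lc) (hF : faceWtSum r Lc ≤ F) (k : ℕ) (μ : Fin (3 + 1)) (z u : Site (3 + 1)) :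
    |((Lc : ℝ) ^ (k + 1)) ^ 4 *
        (Psi (toSite rr) Lc 0 k (delta1 μ z) u + PsiFace r (toSite rr) Lc 0 k (delta1 μ z) u - bmGaugeAt (toSite rr) (respStep (d := 3) 1 (Lc ^ (k + 1)) μ z) Lc u)|
      ≤ 2 * (8 * (Lc : ℝ) * C + F * (1 + 8 * (Lc : ℝ) * (Real.exp κ₀ + 1)) * C) * Real.exp (-(κ₀ * supNorm (quo (Lc ^ (k + 1)) u - z))) := by
  have hL0 : (Lc : ℝ) ≠ 0 := by exact_mod_cast NeZero.ne Lc
  have hF0 : 0 ≤ F := (faceWtSum_nonneg r Lc).trans hF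
  have h := abs_combGauge_le (Lc := Lc) hκ₀ hC hN1 hr hrr hF hLc 0 k μ z u
  rw [pow_zero, Nat.zero_add] at h
  rw [abs_mul, abs_of_nonneg (by positivity)]
  calc ((Lc : ℝ) ^ (k + 1)) ^ 4 *
        |Psi (toSite rr) Lc 0 k (delta1 μ z) u + PsiFace r (toSite rr) Lc 0 k (delta1 μ z) u - bmGaugeAt (toSite rr) (respStep (d := 3) 1 (Lc ^ (k + 1)) μ z) Lc u|
      ≤ ((Lc : ℝ) ^ (k + 1)) ^ 4 *
          ((2 * (8 * (Lc : ℝ) * C * ((Lc : ℝ) ^ (5 * (k + 1)))⁻¹ + F * ((1 + 8 * (Lc : ℝ) * (Real.exp κ₀ + 1)) * C * ((Lc : ℝ) ^ (5 * (k + 1)))⁻¹)) *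
            (Lc : ℝ) ^ (k + 1)) * Real.exp (-(κ₀ * supNorm (quo (Lc ^ (k + 1)) u - z)))) :=
        mul_le_mul_of_nonneg_left h (by positivity)
    _ = 2 * (8 * (Lc : ℝ) * C + F * (1 + 8 * (Lc : ℝ) * (Real.exp κ₀ + 1)) * C) *
          (((Lc : ℝ) ^ ((k + 1) * 4) * (Lc : ℝ) ^ (k + 1) * ((Lc : ℝ) ^ (5 * (k + 1)))⁻¹)) * Real.exp (-(κ₀ * supNorm (quo (Lc ^ (k + 1)) u - z))) := by
        rw [← pow_mul]; ring
    _ = _ := by rw [pow_mul_pow_mul_inv_eq_one hL0 (by ring), mul_one]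

/-- NOT IN PRINT; OUR BOOKKEEPING.  **THE UNIT CONJUGATED GAUGE FUNCTION, DIFFERENCED ACROSS THE TWO TOWERS (SITE LETTER)** (MY `CombContactGaugeRefine.exists_combGauge_refine_site`'s shape):
`|N′^4·λ′_{k+1} x − N^4·λ′_k (quo Lc x)| ≤ (3·α_d·θ^k + 2·α₀·N′⁻¹)·E′(x)` — `N′^4·3α_dθ^kLc^{k+2}·Lc^{−5(k+2)} = 3α_dθ^k`, `N′^4·2α₀·Lc^{−5(k+2)} = 2α₀·(Lc^{k+2})⁻¹`: geometric at `max(θ, Lc⁻¹)`. -/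
theorem abs_unitCombGauge_refine_le
    (hdl : ∀ (k : ℕ) (μ : Fin (3 + 1)) (z : Site (3 + 1)) (u' : Site (3 + 1)),
      |(Psi (toSite rr) Lc 0 (k + 1) (delta1 μ z) u' + PsiFace r (toSite rr) Lc 0 (k + 1) (delta1 μ z) u'
            - bmGaugeAt (toSite rr) (respStep (d := 3) 1 (Lc ^ (k + 2)) μ z) Lc u')
          - ((Lc : ℝ) ^ (3 + 1))⁻¹ *
            (Psi (toSite rr) Lc 0 k (delta1 μ z) (blk Lc u') + PsiFace r (toSite rr) Lc 0 k (delta1 μ z) (blk Lc u')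
              - bmGaugeAt (toSite rr) (respStep (d := 3) 1 (Lc ^ (k + 1)) μ z) Lc (blk Lc u'))|
        ≤ (3 * αd * θ ^ k * (Lc : ℝ) ^ (k + 2) + 2 * α₀) * ((Lc : ℝ) ^ (5 * (k + 2)))⁻¹ * Real.exp (-(κ * supNorm (quo (Lc ^ (k + 2)) u' - z))))
    (k : ℕ) (μ : Fin (3 + 1)) (z : Site (3 + 1)) (x : Site (3 + 1)) :
    |((Lc : ℝ) ^ (k + 2)) ^ 4 *
          (Psi (toSite rr) Lc 0 (k + 1) (delta1 μ z) x + PsiFace r (toSite rr) Lc 0 (k + 1) (delta1 μ z) x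
            - bmGaugeAt (toSite rr) (respStep (d := 3) 1 (Lc ^ (k + 2)) μ z) Lc x)
        - ((Lc : ℝ) ^ (k + 1)) ^ 4 *
          (Psi (toSite rr) Lc 0 k (delta1 μ z) (quo Lc x) + PsiFace r (toSite rr) Lc 0 k (delta1 μ z) (quo Lc x)
            - bmGaugeAt (toSite rr) (respStep (d := 3) 1 (Lc ^ (k + 1)) μ z) Lc (quo Lc x))|
      ≤ (3 * αd * θ ^ k + 2 * α₀ * ((Lc : ℝ) ^ (k + 2))⁻¹) * Real.exp (-(κ * supNorm (quo (Lc ^ (k + 2)) x - z))) := by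
  have hL0 : (Lc : ℝ) ≠ 0 := by exact_mod_cast NeZero.ne Lc
  have h := hdl k μ z x
  have hbq : blk Lc x = quo Lc x := rfl
  rw [hbq] at h
  have e4 : ((Lc : ℝ) ^ (k + 1)) ^ 4 = ((Lc : ℝ) ^ (k + 2)) ^ 4 * ((Lc : ℝ) ^ (3 + 1))⁻¹ := by
    rw [pow_succ (Lc : ℝ) (k + 1), mul_pow]; field_simp
  have e : ((Lc : ℝ) ^ (k + 2)) ^ 4 *
          (Psi (toSite rr) Lc 0 (k + 1) (delta1 μ z) x + PsiFace r (toSite rr) Lc 0 (k + 1) (delta1 μ z) x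
            - bmGaugeAt (toSite rr) (respStep (d := 3) 1 (Lc ^ (k + 2)) μ z) Lc x)
        - ((Lc : ℝ) ^ (k + 1)) ^ 4 *
          (Psi (toSite rr) Lc 0 k (delta1 μ z) (quo Lc x) + PsiFace r (toSite rr) Lc 0 k (delta1 μ z) (quo Lc x)
            - bmGaugeAt (toSite rr) (respStep (d := 3) 1 (Lc ^ (k + 1)) μ z) Lc (quo Lc x))
      = ((Lc : ℝ) ^ (k + 2)) ^ 4 *
        ((Psi (toSite rr) Lc 0 (k + 1) (delta1 μ z) x + PsiFace r (toSite rr) Lc 0 (k + 1) (delta1 μ z) x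
            - bmGaugeAt (toSite rr) (respStep (d := 3) 1 (Lc ^ (k + 2)) μ z) Lc x)
          - ((Lc : ℝ) ^ (3 + 1))⁻¹ *
            (Psi (toSite rr) Lc 0 k (delta1 μ z) (quo Lc x) + PsiFace r (toSite rr) Lc 0 k (delta1 μ z) (quo Lc x)
              - bmGaugeAt (toSite rr) (respStep (d := 3) 1 (Lc ^ (k + 1)) μ z) Lc (quo Lc x))) := by
    rw [e4]; ring
  rw [e, abs_mul, abs_of_nonneg (by positivity)]
  refine (mul_le_mul_of_nonneg_left h (by positivity)).trans (le_of_eq ?_)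
  have e5 : (Lc : ℝ) ^ (5 * (k + 2)) = ((Lc : ℝ) ^ (k + 2)) ^ 4 * (Lc : ℝ) ^ (k + 2) := by rw [← pow_mul, ← pow_add]; congr 1; ring
  rw [e5]
  field_simp

/-- NOT IN PRINT; OUR BOOKKEEPING.  **THE UNIT CONJUGATED GAUGE FUNCTION OF TOWER `k` IS A `(k+2)`-STAIRCASE** (MY `combGauge_eq_staircase_zero`, scaled by `N^4`). -/
theorem unitCombGauge_eq_staircase (r : Fin (3 + 1) → ℕ) (ρ : Fin (3 + 1) → ℤ) (k : ℕ) (μ : Fin (3 + 1)) (z c : Site (3 + 1)) :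
    ((Lc : ℝ) ^ (k + 1)) ^ 4 * (Psi ρ Lc 0 k (delta1 μ z) c + PsiFace r ρ Lc 0 k (delta1 μ z) c - bmGaugeAt ρ (respStep (d := 3) 1 (Lc ^ (k + 1)) μ z) Lc c)
      = ∑ s ∈ Finset.range (k + 1 + 1),
          (fun (s : ℕ) (y : Site (3 + 1)) => ((Lc : ℝ) ^ (k + 1)) ^ 4 *
            ((if s ≤ k then
                -(((Lc : ℝ) ^ ((3 + 1) * s))⁻¹ * bmGaugeAt ρ (legAct (respStep (d := 3) (Lc ^ s) (Lc ^ (k + 1))) (delta1 μ z)) Lc y)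
              else 0)
             + (if s = 0 then (0 : ℝ)
                else ((Lc : ℝ) ^ ((3 + 1) * (s - 1)))⁻¹ * ((((box (3 + 1) Lc).card : ℝ))⁻¹ *
                  zetaS (toSite r) Lc (legAct (legChain (respStepBmSeq (d := 3) ρ Lc) (s - 1) (k - (s - 1))) (delta1 μ z)) y)))) s (blk (Lc ^ s) c) := by
  rw [combGauge_eq_staircase_zero r ρ k μ z c, Finset.mul_sum]

/-- NOT IN PRINT; OUR BOOKKEEPING.  **THE UNIT CONJUGATED PIECES CARRY THE AMPLITUDES `α₀·N⁻¹·Lc^s`** (MY `abs_combPieceZero_le` × `N^4`: `N^4·α₀·Lc^{−5(k+1)}·Lc^s = α₀·Lc^s·N⁻¹`,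
`α₀ = 8LcC + F·(1+8Lc(e^{κ₀}+1))·C`). -/
theorem abs_unitCombGaugePiece_le (hκ₀ : 0 ≤ κ₀) (hC : 0 ≤ C)
    (hN1 : ∀ (m k : ℕ) (μ : Fin (3 + 1)) (z : Site (3 + 1)) (l'' : Fin (3 + 1)) (w' : Site (3 + 1)),
      |respStep (d := 3) (Lc ^ m) (Lc ^ (m + k + 1)) μ z l'' w'| ≤
        C * ((Lc : ℝ) ^ (5 * (k + 1)))⁻¹ * Real.exp (-(κ₀ * supNorm (quo (Lc ^ (k + 1)) w' - z))))
    (hr : r ∈ box (3 + 1) Lc) (hrr : rr ∈ box (3 + 1) Lc) (hF : faceWtSum r Lc ≤ F) (k : ℕ) (μ : Fin (3 + 1)) (z : Site (3 + 1)) {s : ℕ} (hs : s ≤ k + 1)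
    (c' : Site (3 + 1)) :
    |(fun (s : ℕ) (y : Site (3 + 1)) => ((Lc : ℝ) ^ (k + 1)) ^ 4 *
        ((if s ≤ k then
            -(((Lc : ℝ) ^ ((3 + 1) * s))⁻¹ * bmGaugeAt (toSite rr) (legAct (respStep (d := 3) (Lc ^ s) (Lc ^ (k + 1))) (delta1 μ z)) Lc y)
          else 0)
         + (if s = 0 then (0 : ℝ)
            else ((Lc : ℝ) ^ ((3 + 1) * (s - 1)))⁻¹ * ((((box (3 + 1) Lc).card : ℝ))⁻¹ *
              zetaS (toSite r) Lc (legAct (legChain (respStepBmSeq (d := 3) (toSite rr) Lc) (s - 1) (k - (s - 1))) (delta1 μ z)) y)))) s (blk (Lc ^ s) c')|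
      ≤ ((8 * (Lc : ℝ) * C + F * (1 + 8 * (Lc : ℝ) * (Real.exp κ₀ + 1)) * C) * ((Lc : ℝ) ^ (k + 1))⁻¹ * (Lc : ℝ) ^ s) *
          Real.exp (-(κ₀ * supNorm (quo (Lc ^ (k + 1)) c' - z))) := by
  have hL0 : (Lc : ℝ) ≠ 0 := by exact_mod_cast NeZero.ne Lc
  have h := abs_combPieceZero_le (Lc := Lc) hκ₀ hC hN1 hr hrr hF k μ z hs c'
  have h0 := (abs_nonneg _).trans h
  show |((Lc : ℝ) ^ (k + 1)) ^ 4 * _| ≤ _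
  rw [abs_mul, abs_of_nonneg (by positivity : (0 : ℝ) ≤ ((Lc : ℝ) ^ (k + 1)) ^ 4)]
  refine (mul_le_mul_of_nonneg_left h (by positivity)).trans (le_of_eq ?_)
  have e5 : (Lc : ℝ) ^ (5 * (k + 1)) = ((Lc : ℝ) ^ (k + 1)) ^ 4 * (Lc : ℝ) ^ (k + 1) := by rw [← pow_mul, ← pow_add]; congr 1; ring
  rw [e5]
  field_simp

omit [NeZero Lc] in
/-- [folklore] The realignment weight of the `(k+2)`-staircase: `Σ_{s<k+2} (α₀·N⁻¹·Lc^s)·(Lc^s)⁻¹ = (k+2)·α₀·N⁻¹`. -/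
theorem sum_unitCombAmp_eq [NeZero Lc] (k : ℕ) (a : ℝ) :
    ∑ s ∈ Finset.range (k + 1 + 1), (a * ((Lc : ℝ) ^ (k + 1))⁻¹ * (Lc : ℝ) ^ s) * (((Lc ^ s : ℕ) : ℝ))⁻¹
      = ((k : ℝ) + 2) * (a * ((Lc : ℝ) ^ (k + 1))⁻¹) := by
  have hL0 : (Lc : ℝ) ≠ 0 := by exact_mod_cast NeZero.ne Lc
  rw [Finset.sum_congr rfl fun s _ => by
    rw [Nat.cast_pow, mul_assoc, mul_inv_cancel₀ (pow_ne_zero s hL0), mul_one], Finset.sum_const, Finset.card_range, nsmul_eq_mul]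
  push_cast
  ring

end Units

end Summit.QuantumFields.BalabanUV.Beta.GAN24.CombContactRefineBUnits

end
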